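import Mathlib
import HarnessLib

/-!
# Route ParityLeakOneFifth, crux `PlainSplit` (stmt-Parity-18382), skeleton `calib-split`:
# tools for stub `stub_roughLiouvilleTwistedSmall`, I — the dictionary

`A_w = Σ_{n z-rough, w ≤ P⁻(n+2)} λ(n+2) G(n+2)` with `G(m) = Σ_{d ∣ m, d ≤ D, d y-rough} μ(d)` is
rearranged as `Σ_{d ≤ D, y-rough} μ(d) Σ_{n : d ∣ n+2} λ(n+2)` (`sum_mul_sum_divisors_comm`), the inner
sum re-indexed by `n + 2 = dk` (`sum_filter_dvd_shift_eq`), the conditions on `k` written as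
residue classes `k mod p ∉ K_p` for the primes `p < w` (`kcond_iff`), and the window `k ∈ (K₀, K₁]`
shifted to `r = k − K₀ ∈ [1, X]` with shifted classes (`sum_filter_classes_shift`), which is the
shape of the tree's signed interval residue-class sieve `IntervalClassSieve.abs_signedSum_le`.
-/

namespace Summit.Parity.GeneralizedHardyLittlewood.Theorems.ParityLeakOneFifth

open Finset

/-- Residue shift: `r ≡ u − K (mod p)` iff `K + r ≡ u (mod p)`. -/
theorem mod_eq_shift_iff {p : ℕ} (hp : 0 < p) (K r u : ℕ) :
    r % p = (u + (p - K % p)) % p ↔ (K + r) % p = u % p := by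
  haveI : NeZero p := ⟨hp.ne'⟩
  rw [← ZMod.natCast_eq_natCast_iff', ← ZMod.natCast_eq_natCast_iff']
  have h : ((p - K % p : ℕ) : ZMod p) = -(K : ZMod p) := by
    rw [Nat.cast_sub (Nat.mod_lt K hp).le, ZMod.natCast_self, ZMod.natCast_mod, zero_sub]
  rw [Nat.cast_add, h, Nat.cast_add]
  constructor
  · intro e; rw [e]; ring
  · intro e; rw [← e]; ring

/-- The shift `u ↦ (u + (p − K mod p)) mod p` is injective on residues `u < p`. -/
theorem shift_injOn {p : ℕ} (hp : 0 < p) (K : ℕ) :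
    Set.InjOn (fun u : ℕ => (u + (p - K % p)) % p) {u : ℕ | u < p} := by
  intro u₁ hu₁ u₂ hu₂ h
  have h1 : (K + ((u₁ + (p - K % p)) % p)) % p = u₁ % p :=
    (mod_eq_shift_iff hp K _ u₁).1 (by rw [Nat.mod_mod])
  have h2 : (K + ((u₂ + (p - K % p)) % p)) % p = u₂ % p :=
    (mod_eq_shift_iff hp K _ u₂).1 (by rw [Nat.mod_mod])
  simp only at h
  rw [h] at h1
  rw [h1] at h2
  rwa [Nat.mod_eq_of_lt (show u₁ < p from hu₁), Nat.mod_eq_of_lt (show u₂ < p from hu₂)] at h2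

/-- Exchange of summation: `Σ_n f(n) Σ_{d ∣ n+2, P d} h(d) = Σ_{d ≤ Dn, P d} h(d) Σ_{n : d ∣ n+2} f(n)`
when `P d ⇒ d ≤ Dn`. -/
theorem sum_mul_sum_divisors_comm (S : Finset ℕ) (f h : ℕ → ℝ) (P : ℕ → Prop) [DecidablePred P]
    (Dn : ℕ) (hP : ∀ d, P d → d ≤ Dn) :
    ∑ n ∈ S, f n * ∑ d ∈ (Nat.divisors (n + 2)).filter P, h d =
      ∑ d ∈ (Finset.Icc 1 Dn).filter P, h d * ∑ n ∈ S.filter (fun n => d ∣ n + 2), f n := by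
  simp_rw [Finset.mul_sum]
  rw [Finset.sum_comm' (t' := (Finset.Icc 1 Dn).filter P)
    (s' := fun d => S.filter (fun n => d ∣ n + 2))]
  · exact Finset.sum_congr rfl fun d _ => Finset.sum_congr rfl fun n _ => by ring
  · intro n d
    rw [Finset.mem_filter, Nat.mem_divisors, Finset.mem_filter, Finset.mem_filter, Finset.mem_Icc]
    constructor
    · rintro ⟨hn, ⟨hdvd, h0⟩, hPd⟩
      exact ⟨⟨hn, hdvd⟩, ⟨Nat.pos_of_dvd_of_pos hdvd (by omega), hP d hPd⟩, hPd⟩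
    · rintro ⟨⟨hn, hdvd⟩, ⟨h1, -⟩, hPd⟩
      exact ⟨hn, ⟨hdvd, by omega⟩, hPd⟩

/-- Re-indexing `n + 2 = dk`: the `n ∈ (x, 2x]` with `d ∣ n+2` correspond to
`k ∈ ((x+2)/d, (2x+2)/d]`. -/
theorem sum_filter_dvd_shift_eq (x : ℕ) {d : ℕ} (hd : 0 < d) (Q : ℕ → Prop) [DecidablePred Q]
    (f : ℕ → ℝ) :
    ∑ n ∈ (Finset.Ioc x (2 * x)).filter (fun n => Q (n + 2) ∧ d ∣ n + 2), f (n + 2) =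
      ∑ k ∈ (Finset.Ioc ((x + 2) / d) ((2 * x + 2) / d)).filter (fun k => Q (d * k)),
        f (d * k) := by
  refine Finset.sum_nbij' (fun n => (n + 2) / d) (fun k => d * k - 2) ?_ ?_ ?_ ?_ ?_
  · intro n hn
    rw [Finset.mem_filter, Finset.mem_Ioc] at hn
    obtain ⟨⟨h1, h2⟩, hQ, hdvd⟩ := hn
    rw [Finset.mem_filter, Finset.mem_Ioc, Nat.mul_div_cancel' hdvd]
    exact ⟨⟨Nat.div_lt_div_of_lt_of_dvd hdvd (by omega), Nat.div_le_div_right (by omega)⟩, hQ⟩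
  · intro k hk
    rw [Finset.mem_filter, Finset.mem_Ioc] at hk
    obtain ⟨⟨h1, h2⟩, hQ⟩ := hk
    have hk2 : x + 2 < d * k := by
      have := (Nat.div_lt_iff_lt_mul hd).1 h1; rw [mul_comm] at this; exact this
    have hk3 : d * k ≤ 2 * x + 2 := by
      have := (Nat.le_div_iff_mul_le hd).1 h2; rw [mul_comm] at this; exact this
    rw [Finset.mem_filter, Finset.mem_Ioc, Nat.sub_add_cancel (by omega)]
    exact ⟨⟨by omega, by omega⟩, hQ, Dvd.intro k rfl⟩
  · intro n hn
    rw [Finset.mem_filter] at hn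
    rw [Nat.mul_div_cancel' hn.2.2]; omega
  · intro k hk
    rw [Finset.mem_filter, Finset.mem_Ioc] at hk
    have hk2 : x + 2 < d * k := by
      have := (Nat.div_lt_iff_lt_mul hd).1 hk.1.1; rw [mul_comm] at this; exact this
    rw [Nat.sub_add_cancel (by omega), Nat.mul_div_cancel_left k hd]
  · intro n hn
    rw [Finset.mem_filter] at hn
    rw [Nat.mul_div_cancel' hn.2.2]

/-! ### The conditions on `k` as residue classes -/

/-- For a prime `p ∤ d` and `dk ≥ 2`: `p ∣ dk − 2` iff `k ≡ 2·d⁻¹ (mod p)`, i.e.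
`k mod p = (2 d⁻¹ mod p).val`. -/
theorem dvd_mul_sub_two_iff {p d k : ℕ} (hp : p.Prime) (hpd : ¬ p ∣ d) (hdk : 2 ≤ d * k) :
    p ∣ d * k - 2 ↔ k % p = ((2 : ZMod p) * ((d : ZMod p))⁻¹).val := by
  haveI := Fact.mk hp
  have hd0 : (d : ZMod p) ≠ 0 := by
    rwa [Ne, ZMod.natCast_eq_zero_iff]
  have h1 : p ∣ d * k - 2 ↔ ((d : ZMod p) * k) = 2 := by
    rw [← ZMod.natCast_eq_zero_iff, Nat.cast_sub hdk, sub_eq_zero]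
    push_cast; exact Iff.rfl
  have h2 : k % p = ((2 : ZMod p) * ((d : ZMod p))⁻¹).val ↔
      (k : ZMod p) = (2 : ZMod p) * ((d : ZMod p))⁻¹ := by
    conv_rhs => rw [← ZMod.natCast_zmod_val ((2 : ZMod p) * ((d : ZMod p))⁻¹)]
    rw [ZMod.natCast_eq_natCast_iff', Nat.mod_eq_of_lt (ZMod.val_lt _)]
  rw [h1, h2]
  constructor
  · intro h; rw [← h]; field_simp
  · intro h; rw [h]; field_simp

/-- The residue `2·d⁻¹ mod 2` is `0`. -/
theorem val_two_mul_inv_two (d : ℕ) : ((2 : ZMod 2) * ((d : ZMod 2))⁻¹).val = 0 := by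
  have : (2 : ZMod 2) = 0 := by decide
  rw [this, zero_mul, ZMod.val_zero]

/-- For an odd prime `p ∤ d` the residue `2·d⁻¹ mod p` is nonzero. -/
theorem val_two_mul_inv_ne_zero {p d : ℕ} (hp : p.Prime) (hp2 : p ≠ 2) (hpd : ¬ p ∣ d) :
    ((2 : ZMod p) * ((d : ZMod p))⁻¹).val ≠ 0 := by
  haveI := Fact.mk hp
  have hd0 : (d : ZMod p) ≠ 0 := by rwa [Ne, ZMod.natCast_eq_zero_iff]
  have h20 : (2 : ZMod p) ≠ 0 := by
    have : ((2 : ℕ) : ZMod p) ≠ 0 := by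
      rw [Ne, ZMod.natCast_eq_zero_iff, Nat.prime_dvd_prime_iff_eq hp Nat.prime_two]
      exact hp2
    exact_mod_cast this
  rw [Ne, ZMod.val_eq_zero]
  exact mul_ne_zero h20 (inv_ne_zero hd0)

/-- **The conditions on `k`.**  For `d` free of primes `< w`, `z ≤ w` and `dk ≥ 3`:
"`dk − 2` is `z`-rough and `P⁻(dk) ≥ w`" iff "`k mod p ∉ K_p` for every prime `p < w`", where
`K_p = {0, 2d⁻¹ mod p}` for `p < z` and `K_p = {0}` for `z ≤ p < w`. -/
theorem kcond_iff {d k : ℕ} {z w : ℝ} (hzw : z ≤ w) (hd : ∀ p : ℕ, p.Prime → (p : ℝ) < w → ¬ p ∣ d)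
    (hdk : 3 ≤ d * k) :
    ((∀ p ∈ (d * k - 2).primeFactors, z ≤ (p : ℝ)) ∧ w ≤ ((d * k).minFac : ℝ)) ↔
      ∀ p ∈ Nat.primesBelow ⌈w⌉₊, k % p ∉
        (if (p : ℝ) < z then ({0, ((2 : ZMod p) * ((d : ZMod p))⁻¹).val} : Finset ℕ) else {0}) := by
  have hmem : ∀ p : ℕ, p ∈ Nat.primesBelow ⌈w⌉₊ ↔ p.Prime ∧ (p : ℝ) < w := by
    intro p
    rw [Nat.mem_primesBelow, Nat.lt_ceil]
    tauto
  constructor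
  · rintro ⟨hr, hw⟩ p hp
    rw [hmem] at hp
    obtain ⟨hpp, hpw⟩ := hp
    have hk0 : k % p ≠ 0 := by
      intro h
      have hpk : p ∣ d * k := dvd_mul_of_dvd_right (Nat.dvd_of_mod_eq_zero h) d
      have := Nat.minFac_le_of_dvd hpp.two_le hpk
      have : ((d * k).minFac : ℝ) ≤ p := by exact_mod_cast this
      linarith
    split_ifs with hpz
    · rw [Finset.mem_insert, Finset.mem_singleton, not_or]
      refine ⟨hk0, fun h => ?_⟩
      have hdvd : p ∣ d * k - 2 := (dvd_mul_sub_two_iff hpp (hd p hpp hpw) (by omega)).2 h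
      have hpf : p ∈ (d * k - 2).primeFactors := Nat.mem_primeFactors.2 ⟨hpp, hdvd, by omega⟩
      have := hr p hpf
      linarith
    · rwa [Finset.mem_singleton]
  · intro hK
    refine ⟨fun p hpf => ?_, ?_⟩
    · obtain ⟨hpp, hdvd, -⟩ := Nat.mem_primeFactors.1 hpf
      by_contra hlt
      push Not at hlt
      have hpw : (p : ℝ) < w := hlt.trans_le hzw
      have h := hK p ((hmem p).2 ⟨hpp, hpw⟩)
      rw [if_pos hlt, Finset.mem_insert, Finset.mem_singleton, not_or] at h
      exact h.2 ((dvd_mul_sub_two_iff hpp (hd p hpp hpw) (by omega)).1 hdvd)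
    · by_contra hlt
      push Not at hlt
      have hm1 : d * k ≠ 1 := by omega
      have hq := Nat.minFac_prime hm1
      have hqw : ((d * k).minFac : ℝ) < w := hlt
      have h := hK _ ((hmem _).2 ⟨hq, hqw⟩)
      have h0 : k % (d * k).minFac ≠ 0 := by
        intro h0; rw [h0] at h
        split_ifs at h <;> simp at h
      have hndk : ¬ (d * k).minFac ∣ d * k := by
        intro hdiv
        rcases (Nat.Prime.dvd_mul hq).1 hdiv with h1 | h1
        · exact hd _ hq hqw h1
        · exact h0 (Nat.mod_eq_zero_of_dvd h1)
      exact hndk (Nat.minFac_dvd _)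

/-! ### Shifting the window to `[1, X]` -/

/-- The shifted classes lie in `[0, p)`. -/
theorem shift_classes_lt {p : ℕ} (hp : 0 < p) (K : ℕ) (S : Finset ℕ) :
    ∀ r ∈ S.image (fun u : ℕ => (u + (p - K % p)) % p), r < p := by
  intro r hr
  obtain ⟨u, -, rfl⟩ := Finset.mem_image.1 hr
  exact Nat.mod_lt _ hp

/-- The shift preserves the number of classes (all `< p`). -/
theorem card_shift_classes {p : ℕ} (hp : 0 < p) (K : ℕ) {S : Finset ℕ} (hS : ∀ u ∈ S, u < p) :
    #(S.image (fun u : ℕ => (u + (p - K % p)) % p)) = #S :=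
  Finset.card_image_of_injOn fun u₁ hu₁ u₂ hu₂ h => shift_injOn hp K (hS u₁ hu₁) (hS u₂ hu₂) h

/-- Membership in the shifted classes: `r mod p ∈ shift(S)` iff `(K + r) mod p ∈ S` (all elements
of `S` being `< p`). -/
theorem mod_mem_shift_iff {p : ℕ} (hp : 0 < p) (K r : ℕ) {S : Finset ℕ} (hS : ∀ u ∈ S, u < p) :
    r % p ∈ S.image (fun u : ℕ => (u + (p - K % p)) % p) ↔ (K + r) % p ∈ S := by
  rw [Finset.mem_image]
  constructor
  · rintro ⟨u, hu, h⟩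
    have := (mod_eq_shift_iff hp K r u).1 h.symm
    rwa [this, Nat.mod_eq_of_lt (hS u hu)]
  · intro h
    refine ⟨(K + r) % p, h, ?_⟩
    exact ((mod_eq_shift_iff hp K r _).2 (by rw [Nat.mod_mod])).symm

/-- **Shift of the window.**  `Σ_{k ∈ (K₀, K₁], k mod p ∉ K_p ∀ p} f(k)
= Σ_{r ∈ [1, K₁−K₀], r mod p ∉ shift(K_p) ∀ p} f(K₀ + r)`. -/
theorem sum_filter_classes_shift {K₀ K₁ : ℕ} (hK : K₀ ≤ K₁) (PB : Finset ℕ) (Kc : ℕ → Finset ℕ)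
    (hKc : ∀ p ∈ PB, 0 < p ∧ ∀ u ∈ Kc p, u < p) (f : ℕ → ℝ) :
    ∑ k ∈ (Finset.Ioc K₀ K₁).filter (fun k => ∀ p ∈ PB, k % p ∉ Kc p), f k =
      ∑ r ∈ (Finset.Icc 1 (K₁ - K₀)).filter
        (fun r => ∀ p ∈ PB, r % p ∉ (Kc p).image (fun u : ℕ => (u + (p - K₀ % p)) % p)),
        f (K₀ + r) := by
  have hI : Finset.Ioc K₀ K₁ = (Finset.Icc 1 (K₁ - K₀)).map (addLeftEmbedding K₀) := by
    rw [Finset.map_add_left_Icc, Finset.Icc_add_one_left_eq_Ioc]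
    congr 1; omega
  rw [hI, Finset.filter_map, Finset.sum_map]
  refine Finset.sum_congr ?_ fun r _ => rfl
  apply Finset.filter_congr
  intro r _
  simp only [Function.comp_apply, addLeftEmbedding_apply]
  refine forall₂_congr fun p hp => ?_
  rw [mod_mem_shift_iff (hKc p hp).1 K₀ r (hKc p hp).2]

end Summit.Parity.GeneralizedHardyLittlewood.Theorems.ParityLeakOneFifth
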